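import Summits.BirchSwinnertonDyer.BirchSwinnertonDyer.Theorems.Rank2Observatory2DescClFamCert
import Summits.BirchSwinnertonDyer.BirchSwinnertonDyer.Theorems.Rank2Observatory2DescClCoreCert
import HarnessLib

/-!
# BirchSwinnertonDyer — rank ≥ 2 observatory: KERNEL-2DESC-CL v2.1 — family-entry soundness from the signature-free core

HONEST FRAMING: per-curve certified theorems and census instruments; no claim on BSD in rank ≥ 2.

File 4 of KERNEL-2DESC-CL v2.0 (`…2DescClFamCert`) proves the soundness of the family-entry checker
`famCheck` under `fc.check = true`, whose archimedean clause restricts it to COMPLEX cubic fields.  Every one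
of those lemmas in fact uses only the signature-free core `fc.checkCore` (`…2DescClCoreCert`) — plus, for the
sign bit, `0 ≤ lo`.  This file re-derives them in that generality so that the SAME computable `famCheck`, the
same `FamEntry` rows and the same registry serve the totally real 2-division fields of v2.1
(`…2DescClRealCert`): the primes `W₁c`, `W₂c` above the auxiliary prime `q` (`W₁c_asIdeal`, `W₁c_ne_W₂c`,
`absNorm_W₁c`, `q_mem_W₁c`, `eq_W₁c_or_W₂c`, …), and per family entry `lin_ne_zero_of_famCheck_core`,
`norm_of_famCheck_core`, `sign_iff_of_famCheck_core` / `rho_ne_zero_of_famCheck_core` (place with interval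
`(lo, hi)`), `supp_of_famCheck_core`, `log_W₁c_of_famCheck`, `log_W₂c_of_famCheck`.  The proofs are those of
file 4 with the hypothesis weakened.  Sorry-free; axioms `propext`, `Classical.choice`, `Quot.sound`.
[cite: Cassels1991LecturesEllipticCurves, §15] [cite: Cohen1993, §4.8.2, §6.5] [cite: SchaeferStoll2004, §5]
-/

set_option linter.dupNamespace false

noncomputable section

open scoped Classical NumberField nonZeroDivisors

open Literature.NumberTheory.NumberFields Polynomial Module NumberField IsDedekindDomain Ideal
  IsDedekindDomain.HeightOneSpectrum

namespace Summit.BirchSwinnertonDyer.BirchSwinnertonDyer.Rank2Observatory.TwoDescCl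

open TwoDescCubic MonicCubic

variable {K : Type*} [Field K] [NumberField K] {θ : K} (fc : ClFieldCert)

namespace ClFieldCert

/-- **`W₁c`** as a height-one prime. -/
def W₁c (hθ : aeval θ (MonicCubic.poly fc.a fc.b fc.c) = 0) (h3 : finrank ℚ K = 3) (hC : fc.checkCore = true)
    (hpr : fc.primeList.Forall Nat.Prime) : HeightOneSpectrum (𝓞 K) :=
  primeOfCode (fc.irreducible_of_core hC) hθ h3 (e := fc.qEntry) (fc.q_prime hpr) (fc.qEntry_check_core hC)
    fc.w₁_mem_codes

/-- **`W₂c`** as a height-one prime. -/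
def W₂c (hθ : aeval θ (MonicCubic.poly fc.a fc.b fc.c) = 0) (h3 : finrank ℚ K = 3) (hC : fc.checkCore = true)
    (hpr : fc.primeList.Forall Nat.Prime) : HeightOneSpectrum (𝓞 K) :=
  primeOfCode (fc.irreducible_of_core hC) hθ h3 (e := fc.qEntry) (fc.q_prime hpr) (fc.qEntry_check_core hC)
    fc.w₂_mem_codes

variable {fc}

section W
variable (hθ : aeval θ (MonicCubic.poly fc.a fc.b fc.c) = 0) (h3 : finrank ℚ K = 3) (hC : fc.checkCore = true)
  (hpr : fc.primeList.Forall Nat.Prime)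

/-- `W₁c` is presented by its code. [folklore] -/
theorem W₁c_asIdeal : (fc.W₁c hθ h3 hC hpr).asIdeal = idealOf hθ fc.w₁ := rfl

/-- `W₂c` is presented by its code. [folklore] -/
theorem W₂c_asIdeal : (fc.W₂c hθ h3 hC hpr).asIdeal = idealOf hθ fc.w₂ := rfl

/-- `W₁c ≠ W₂c`. [folklore] -/
theorem W₁c_ne_W₂c : fc.W₁c hθ h3 hC hpr ≠ fc.W₂c hθ h3 hC hpr := fun h =>
  fc.w₁_ne_w₂_core hθ h3 hC hpr (congrArg HeightOneSpectrum.asIdeal h)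

/-- `N(W₁c) = q`. [cite: Cohen1993, §4.8.2, Thm. 4.8.13] -/
theorem absNorm_W₁c : absNorm (fc.W₁c hθ h3 hC hpr).asIdeal = fc.q := (fc.w₁_of_core hθ h3 hC hpr).2

/-- `N(W₂c) = q²`. [cite: Cohen1993, §4.8.2, Thm. 4.8.13] -/
theorem absNorm_W₂c : absNorm (fc.W₂c hθ h3 hC hpr).asIdeal = fc.q ^ 2 := (fc.w₂_of_core hθ h3 hC hpr).2

/-- `q ∈ W₁c`. [folklore] -/
theorem q_mem_W₁c : ((fc.q : ℕ) : 𝓞 K) ∈ (fc.W₁c hθ h3 hC hpr).asIdeal :=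
  natCast_mem_idealOf hθ (e := fc.qEntry) fc.w₁_mem_codes

/-- `q ∈ W₂c`. [folklore] -/
theorem q_mem_W₂c : ((fc.q : ℕ) : 𝓞 K) ∈ (fc.W₂c hθ h3 hC hpr).asIdeal :=
  natCast_mem_idealOf hθ (e := fc.qEntry) fc.w₂_mem_codes

/-- Every height-one prime containing `q` is `W₁c` or `W₂c`. [cite: Cohen1993, §4.8.2, Thm. 4.8.13] -/
theorem eq_W₁c_or_W₂c (u : HeightOneSpectrum (𝓞 K)) (hu : ((fc.q : ℕ) : 𝓞 K) ∈ u.asIdeal) :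
    u = fc.W₁c hθ h3 hC hpr ∨ u = fc.W₂c hθ h3 hC hpr := by
  rcases fc.qcover_of_core hθ h3 hC hpr u.asIdeal u.isPrime hu with h | h
  · exact Or.inl (HeightOneSpectrum.ext h)
  · exact Or.inr (HeightOneSpectrum.ext h)

end W

end ClFieldCert

open ClFieldCert

variable {fc} {D : ℤ × ℤ × ℤ} {f : FamEntry}

/-- The entry is non-zero. [folklore] -/
theorem lin_ne_zero_of_famCheck_core (hθ : aeval θ (MonicCubic.poly fc.a fc.b fc.c) = 0) (h3 : finrank ℚ K = 3)
    (hC : fc.checkCore = true) (h : famCheck fc D f = true) :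
    (lin hθ f.2.2.g.1 f.2.2.g.2.1 f.2.2.g.2.2 : 𝓞 K) ≠ 0 :=
  lin_ne_zero_of_coords (fc.irreducible_of_core hC) hθ h3 _ (common_of_famCheck h).2.1

/-- The norm of the entry. [cite: Marcus2018, Ch. 2, Thm. 4] -/
theorem norm_of_famCheck_core (hθ : aeval θ (MonicCubic.poly fc.a fc.b fc.c) = 0) (h3 : finrank ℚ K = 3)
    (hC : fc.checkCore = true) :
    Algebra.norm ℚ ((lin hθ f.2.2.g.1 f.2.2.g.2.1 f.2.2.g.2.2 : 𝓞 K) : K) =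
      ((normFormZ fc.a fc.b fc.c f.2.2.g.1 f.2.2.g.2.1 f.2.2.g.2.2 : ℤ) : ℚ) :=
  norm_lin_coords (fc.irreducible_of_core hC) hθ h3 _

/-- The sign bit. [cite: Cassels1991LecturesEllipticCurves, §15] -/
theorem sign_iff_of_famCheck_core (hθ : aeval θ (MonicCubic.poly fc.a fc.b fc.c) = 0) (ρ : K →+* ℝ)
    (hlo : ((fc.lo : ℚ) : ℝ) < ρ θ) (hhi : ρ θ < ((fc.hi : ℚ) : ℝ)) (h0 : 0 ≤ fc.lo)
    (h : famCheck fc D f = true) :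
    (f.2.2.sg = true ↔ ρ ((lin hθ f.2.2.g.1 f.2.2.g.2.1 f.2.2.g.2.2 : 𝓞 K) : K) < 0) :=
  sign_iff_of_signCond hθ ρ h0 hlo hhi (common_of_famCheck h).1

/-- The entry is non-zero at the real place. -/
theorem rho_ne_zero_of_famCheck_core (hθ : aeval θ (MonicCubic.poly fc.a fc.b fc.c) = 0) (ρ : K →+* ℝ)
    (hlo : ((fc.lo : ℚ) : ℝ) < ρ θ) (hhi : ρ θ < ((fc.hi : ℚ) : ℝ)) (h0 : 0 ≤ fc.lo)
    (h : famCheck fc D f = true) :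
    ρ ((lin hθ f.2.2.g.1 f.2.2.g.2.1 f.2.2.g.2.2 : 𝓞 K) : K) ≠ 0 :=
  rho_lin_ne_zero_of_signCond hθ ρ h0 hlo hhi (common_of_famCheck h).1

/-- **Support**: every prime containing the entry contains `M = D·q`. [cite: Marcus2018, Ch. 3, Thm. 22] -/
theorem supp_of_famCheck_core (hθ : aeval θ (MonicCubic.poly fc.a fc.b fc.c) = 0) (h3 : finrank ℚ K = 3)
    (hC : fc.checkCore = true) (hpr : fc.primeList.Forall Nat.Prime) (h : famCheck fc D f = true)
    (v : HeightOneSpectrum (𝓞 K)) (hv : (lin hθ f.2.2.g.1 f.2.2.g.2.1 f.2.2.g.2.2 : 𝓞 K) ∈ v.asIdeal) :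
    (lin hθ D.1 D.2.1 D.2.2 : 𝓞 K) * ((fc.q : ℕ) : 𝓞 K) ∈ v.asIdeal := by
  have hirr := fc.irreducible_of_core hC
  have hk := (common_of_famCheck h).2.2.2
  unfold famKindCheck at hk
  split_ifs at hk with h0 h1 h2 h3'
  · exact absurd hv (not_mem_of_unitCert hθ hk v)
  · rw [decide_eq_true_eq] at hk
    rw [hk] at hv
    simp only at hv
    rw [lin_q hθ] at hv
    exact Ideal.mul_mem_left _ _ hv
  · simp only [Bool.and_eq_true, decide_eq_true_eq, List.all_eq_true, Bool.or_eq_true, beq_iff_eq,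
      List.any_eq_true] at hk
    obtain ⟨⟨⟨⟨⟨⟨hany, hCm⟩, hmem⟩, hpp⟩, -⟩, -⟩, hinvs⟩ := hk
    obtain ⟨hrow, hrowp⟩ := row_mem (fc := fc) (by simpa [List.any_eq_true] using hany)
    rcases natCast_mem_or_of_prodPowCert hθ hpp v hv with hp | hq
    · have hp' : ((fc.row f.2.1.1).p : 𝓞 K) ∈ v.asIdeal := by rw [hrowp]; exact hp
      obtain ⟨C', hC', hv'⟩ := exists_code_of_natCast_mem hirr hθ h3 (fc.prime_of_mem hpr hrow)
        (fc.row_check_of_mem_core hC hrow).1 v hp'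
      rcases hinvs C' hC' with rfl | ⟨y, -, hy⟩
      · exact Ideal.mul_mem_right _ _ (lin_mem_of_memCode hθ v hv' D hmem)
      · exact absurd hv (lin_not_mem_of_invCert hθ v hv' hy)
    · exact Ideal.mul_mem_left _ _ hq
  · simp only [Bool.and_eq_true] at hk
    rcases natCast_mem_or_of_prodPowCert hθ hk.1.1 v hv with h1' | hq
    · exact absurd (v.isPrime.ne_top ((Ideal.eq_top_iff_one _).mpr (by simpa using h1'))) id
    · exact Ideal.mul_mem_left _ _ hq

/-- `|N(g)| = q^e · m`, `q ∤ m`, from `ordCheck`. [folklore] -/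
theorem natAbs_norm_of_ordCheck_core (hθ : aeval θ (MonicCubic.poly fc.a fc.b fc.c) = 0) (h3 : finrank ℚ K = 3)
    (hC : fc.checkCore = true) {g : ℤ × ℤ × ℤ} {e : ℕ}
    (h : ordCheck fc.q (normFormZ fc.a fc.b fc.c g.1 g.2.1 g.2.2).natAbs e = true) :
    (Algebra.norm ℤ (lin hθ g.1 g.2.1 g.2.2 : 𝓞 K)).natAbs =
        fc.q ^ e * ((normFormZ fc.a fc.b fc.c g.1 g.2.1 g.2.2).natAbs / fc.q ^ e) ∧
      ¬ fc.q ∣ (normFormZ fc.a fc.b fc.c g.1 g.2.1 g.2.2).natAbs / fc.q ^ e := by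
  simp only [ordCheck, decide_eq_true_eq] at h
  rw [natAbs_norm_lin_coords (fc.irreducible_of_core hC) hθ h3]
  exact h

/-- **`log ord_{W₁c}` of the entry.** [cite: Marcus2018, Ch. 3, Thm. 22] -/
theorem log_W₁c_of_famCheck (hθ : aeval θ (MonicCubic.poly fc.a fc.b fc.c) = 0) (h3 : finrank ℚ K = 3)
    (hC : fc.checkCore = true) (hpr : fc.primeList.Forall Nat.Prime) (h : famCheck fc D f = true) :
    WithZero.log ((fc.W₁c hθ h3 hC hpr).valuation K ((lin hθ f.2.2.g.1 f.2.2.g.2.1 f.2.2.g.2.2 : 𝓞 K) : K)) =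
      famL₁ f := by
  have hq := fc.q_prime hpr
  have hk := (common_of_famCheck h).2.2.2
  unfold famKindCheck at hk
  unfold famL₁
  -- the generic `(−e, 0)` computation for kinds `2` and `3`
  have gen : invCert fc.a fc.b fc.c fc.w₂ f.2.2.g f.2.2.inv2 = true →
      ordCheck fc.q (normFormZ fc.a fc.b fc.c f.2.2.g.1 f.2.2.g.2.1 f.2.2.g.2.2).natAbs f.2.2.e = true →
      WithZero.log ((fc.W₁c hθ h3 hC hpr).valuation K
        ((lin hθ f.2.2.g.1 f.2.2.g.2.1 f.2.2.g.2.2 : 𝓞 K) : K)) = -(f.2.2.e : ℤ) := by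
    intro hinv hord
    obtain ⟨hN, hm⟩ := natAbs_norm_of_ordCheck_core hθ h3 hC hord
    refine log_valuation_eq_of_forall_not_mem hq ({fc.W₁c hθ h3 hC hpr, fc.W₂c hθ h3 hC hpr} : Finset _)
      (fun u hu => by
        rcases eq_W₁c_or_W₂c hθ h3 hC hpr u hu with h | h <;> simp [h])
      (fun u => if u = fc.W₁c hθ h3 hC hpr then 1 else 2) (fun u hu => ?_) (by simp) (by simp) ?_ ?_ hm
    · simp only [Finset.mem_insert, Finset.mem_singleton] at hu
      rcases hu with rfl | rfl
      · simp [absNorm_W₁c]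
      · rw [if_neg (W₁c_ne_W₂c hθ h3 hC hpr).symm]; exact absNorm_W₂c hθ h3 hC hpr
    · intro u hu hne
      simp only [Finset.mem_insert, Finset.mem_singleton] at hu
      rcases hu with rfl | rfl
      · exact absurd rfl hne
      · exact lin_not_mem_of_invCert hθ _ (W₂c_asIdeal hθ h3 hC hpr) hinv
    · simpa using hN
  split_ifs at hk ⊢ with h0 h1 h2 h3'
  · exact log_valuation_eq_zero_of_unitCert hθ hk _
  · rw [decide_eq_true_eq] at hk
    rw [hk]
    simp only
    rw [lin_q hθ]
    have hN : (Algebra.norm ℤ ((fc.q : ℕ) : 𝓞 K)).natAbs = fc.q ^ 3 * 1 := by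
      have e := natAbs_norm_lin_coords (fc.irreducible_of_core hC) hθ h3 ((fc.q : ℤ), 0, 0)
      simp only at e
      rw [lin_q hθ] at e
      rw [e]
      simp [normFormZ, Int.natAbs_pow]
    have hm : ¬ fc.q ∣ 1 := fun hd => hq.one_lt.ne' (Nat.dvd_one.mp hd)
    exact (log_valuation_eq_neg_one_of_one_two hq (W₁c_ne_W₂c hθ h3 hC hpr) (eq_W₁c_or_W₂c hθ h3 hC hpr)
      (absNorm_W₁c hθ h3 hC hpr) (absNorm_W₂c hθ h3 hC hpr) (q_mem_W₁c hθ h3 hC hpr) (q_mem_W₂c hθ h3 hC hpr)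
      hN hm).1
  · simp only [Bool.and_eq_true] at hk
    exact gen hk.1.1.2 hk.1.2
  · simp only [Bool.and_eq_true] at hk
    exact gen hk.1.2 hk.2

/-- **`log ord_{W₂c}` of the entry.** [cite: Marcus2018, Ch. 3, Thm. 22] -/
theorem log_W₂c_of_famCheck (hθ : aeval θ (MonicCubic.poly fc.a fc.b fc.c) = 0) (h3 : finrank ℚ K = 3)
    (hC : fc.checkCore = true) (hpr : fc.primeList.Forall Nat.Prime) (h : famCheck fc D f = true) :
    WithZero.log ((fc.W₂c hθ h3 hC hpr).valuation K ((lin hθ f.2.2.g.1 f.2.2.g.2.1 f.2.2.g.2.2 : 𝓞 K) : K)) =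
      famL₂ f := by
  have hq := fc.q_prime hpr
  have hk := (common_of_famCheck h).2.2.2
  unfold famKindCheck at hk
  unfold famL₂
  by_cases h1 : f.1 = 1
  · have h0 : ¬ f.1 = 0 := by omega
    rw [if_neg h0, if_pos h1, decide_eq_true_eq] at hk
    rw [if_pos h1, hk]
    simp only
    rw [lin_q hθ]
    have hN : (Algebra.norm ℤ ((fc.q : ℕ) : 𝓞 K)).natAbs = fc.q ^ 3 * 1 := by
      have e := natAbs_norm_lin_coords (fc.irreducible_of_core hC) hθ h3 ((fc.q : ℤ), 0, 0)
      simp only at e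
      rw [lin_q hθ] at e
      rw [e]
      simp [normFormZ, Int.natAbs_pow]
    have hm : ¬ fc.q ∣ 1 := fun hd => hq.one_lt.ne' (Nat.dvd_one.mp hd)
    exact (log_valuation_eq_neg_one_of_one_two hq (W₁c_ne_W₂c hθ h3 hC hpr) (eq_W₁c_or_W₂c hθ h3 hC hpr)
      (absNorm_W₁c hθ h3 hC hpr) (absNorm_W₂c hθ h3 hC hpr) (q_mem_W₁c hθ h3 hC hpr) (q_mem_W₂c hθ h3 hC hpr)
      hN hm).2
  rw [if_neg h1]
  have hval : (fc.W₂c hθ h3 hC hpr).valuation K ((lin hθ f.2.2.g.1 f.2.2.g.2.1 f.2.2.g.2.2 : 𝓞 K) : K) = 1 := by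
    split_ifs at hk with h0 h2 h3'
    · exact valuation_eq_one_of_unitCert hθ hk _
    · simp only [Bool.and_eq_true] at hk
      exact valuation_eq_one_of_invCert hθ _ (W₂c_asIdeal hθ h3 hC hpr) hk.1.1.2
    · simp only [Bool.and_eq_true] at hk
      exact valuation_eq_one_of_invCert hθ _ (W₂c_asIdeal hθ h3 hC hpr) hk.1.2
  rw [hval, WithZero.log_one]

/-! ## Kernel sanity checks (`M283`: `ε = −4 − α²`, `γ = 10 + α²` with `γ(36 + α − 6α²) = 19²`, the element `q = 19`) -/

example : famCheck m283 (23, -5, 7) (0, (0, 0, 0, 0), m283.fu) = true := by decide +kernel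

example : famCheck m283 (23, -5, 7) (3, (0, 0, 0, 0), m283.gam) = true := by decide +kernel

example : famCheck m283 (23, -5, 7) (1, (0, 0, 0, 0), ⟨(0, 0, 0), (19, 0, 0), false, (0, 0, 0), 0, 0, (0, 0, 0), []⟩) =
    true := by decide +kernel

end Summit.BirchSwinnertonDyer.BirchSwinnertonDyer.Rank2Observatory.TwoDescCl
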